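import Literature.Computability.Complexity.ProbabilisticClasses
import Literature.Computability.Complexity.CoinCounting
import Literature.Computability.Complexity.NondeterministicProofs
import Literature.Computability.Complexity.CoinTruncation
import Literature.Computability.Complexity.StringCopy
import HarnessLib

/-!
# `P ⊆ BPP ⊆ PP`, `co BPP = BPP` (proofs; trunk CplxCore)

Sibling proof file of `ProbabilisticClasses.lean` (D-0014). Discharges five of its named facts by
elementary counting (no machine constructions beyond `P_closed_boolUnpair_fst`,
`compl_mem_P_iff` (`Classes.lean`), the re-pairing normaliser `polyTimeComputable_boolUnpair`
(`PairingMachines.lean`) and machine composition `PolyTimeComputable.comp_holds`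
(`TimeBoundsProofs.lean`)):

* `P_subset_BPP_holds` — ignore the coins (Gill 1977, Prop. 5.1);
* `BPP_subset_PP_holds` — a `2/3`-majority of correct verdicts is a strict majority for `L'` on
  `x ∈ L` and a strict minority on `x ∉ L` (Gill 1977, Prop. 5.1);
* `co_BPP_holds` — replace the witness language by its complement (`PolyTimeDecidable.compl_holds`);
  the event "the verdict is correct" is unchanged (Arora–Barak 2009, §7.1);
* `RP_subset_BPP_holds` — two independent runs on the two halves of the coin string
  (`truncSndFn`/`dropSndFn`, `CoinTruncation.lean`; `union_mem_P`, `StringCopy.lean`; the product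
  rule `cnt_take_drop`) push the one-sided error `1/2` down to `1/4` (Arora–Barak 2009, §7.3);
* `mem_BPP_iff_randAlg_holds` — Gill's machine form of `BPP` (Gill 1977, Def. 5.1(ii);
  Arora–Barak 2009, Def. 7.2 ↔ Def. 7.3): `(→)` run `(x, r) ↦ [⟨x, r⟩ ∈ L']` with exactly `p(n)`
  coins; `(←)` the witness `{w | A.run (boolUnpair w) = 1}` is in `P` by composing the machine of
  `A` with the re-pairing normaliser (malformed strings), and `RandAlg.pr` is the counting
  probability `uniformProb`.

`NP ⊆ PP` is `CountingHierarchyPH.NP_subset_PP_holds` (it needs the coin transducers there).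

## References

* J. Gill, *Computational complexity of probabilistic Turing machines*, SIAM J. Comput. 6 (1977),
  675–695, Def. 2.8 (bounded error), Def. 5.1 (PP, BPP, ZPP; p. 685), Prop. 5.1–5.2.
  doi:10.1137/0206049
* S. Arora, B. Barak, *Computational Complexity: A Modern Approach*, CUP 2009, §7.1 (Def. 7.2,
  p. 125; Def. 7.3 "BPP, alternative definition", p. 126), §7.3, §17.2.1.
-/

namespace Literature.Computability.Complexity

open _root_.Computability Polynomial

/-- **Discharge of `P_subset_BPP`**: for `L ∈ P` take `L' = {w | (boolUnpair w).1 ∈ L} ∈ P`; every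
coin string then gives the correct verdict. [cite: Gill1977, Prop. 5.1] -/
theorem P_subset_BPP_holds : P_subset_BPP := by
  intro L hL
  set L' : Language Bool := {w | (boolUnpair w).1 ∈ L} with hL'
  refine ⟨L', P_closed_boolUnpair_fst L hL, 0, fun x => ?_⟩
  have hset : {y : List Bool | boolPair x y ∈ L' ↔ x ∈ L} = Set.univ := by
    refine Set.eq_univ_of_forall fun y => ?_
    change (boolUnpair (boolPair x y)).1 ∈ L ↔ x ∈ L
    rw [boolUnpair_boolPair]
  rw [hset, uniformProb_univ]
  norm_num

/-- **Discharge of `co_BPP`**: `co BPP = BPP`. For `L ∈ BPP` with witness `L' ∈ P`, the complement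
`Lᶜ` has witness `L'ᶜ ∈ P` with the same polynomial: the events
`{y | ⟨x,y⟩ ∈ L'ᶜ ↔ x ∈ Lᶜ}` and `{y | ⟨x,y⟩ ∈ L' ↔ x ∈ L}` coincide. [cite: AroraBarakCC2009, §7.1] -/
theorem co_BPP_holds : co_BPP := by
  have key : ∀ L : Language Bool, L ∈ BPP → Lᶜ ∈ BPP := by
    rintro L ⟨L', hL', p, hp⟩
    refine ⟨L'ᶜ, compl_mem_P_iff.2 hL', p, fun x => ?_⟩
    have hset : {y : List Bool | boolPair x y ∈ L'ᶜ ↔ x ∈ Lᶜ} = {y | boolPair x y ∈ L' ↔ x ∈ L} := by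
      ext y
      change (¬ boolPair x y ∈ L' ↔ ¬ x ∈ L) ↔ (boolPair x y ∈ L' ↔ x ∈ L)
      exact not_iff_not
    rw [hset]
    exact hp x
  ext L
  refine ⟨fun h => ?_, fun h => key L h⟩
  have h' : Lᶜᶜ ∈ BPP := key _ h
  rwa [compl_compl] at h'

/-- **Discharge of `BPP_subset_PP`** (Gill 1977, Prop. 5.1): with the same witness language, if
`x ∈ L` then `Pr[⟨x,y⟩ ∈ L'] ≥ 2/3 > 1/2`, and if `x ∉ L` then `Pr[⟨x,y⟩ ∈ L'] ≤ 1/3 < 1/2`.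
[cite: Gill1977, Prop. 5.1] -/
theorem BPP_subset_PP_holds : BPP_subset_PP := by
  rintro L ⟨L', hL', p, hp⟩
  refine ⟨L', hL', p, fun x => ?_⟩
  have h := hp x
  by_cases hx : x ∈ L
  · have hset : {y : List Bool | boolPair x y ∈ L' ↔ x ∈ L} = {y | boolPair x y ∈ L'} := by
      ext y; simp [hx]
    rw [hset] at h
    simp only [hx, true_iff]
    linarith
  · have hset : {y : List Bool | boolPair x y ∈ L' ↔ x ∈ L} = {y | boolPair x y ∈ L'}ᶜ := by
      ext y; simp [hx]
    rw [hset, uniformProb_compl] at h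
    simp only [hx, false_iff, not_lt]
    linarith

/-! ### `RP ⊆ BPP`: two independent runs -/

/-- **Product rule for independent coin blocks**: the strings of length `m + d` whose prefix of
length `m` lies in `E` and whose suffix lies in `F` number `cnt m E · cnt d F`. [Arora–Barak 2009,
§7.4.1 (independent repetitions)] [folklore] -/
theorem cnt_take_drop (m d : ℕ) (E F : Set (List Bool)) :
    cnt (m + d) {y | y.take m ∈ E ∧ y.drop m ∈ F} = cnt m E * cnt d F := by
  classical
  -- `cnt` as the cardinality of a subtype (instance-agnostic form)
  have hsub : ∀ (n : ℕ) (S : Set (List Bool)),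
      cnt n S = Fintype.card {r : List.Vector Bool n // r.toList ∈ S} := fun n S => by
    unfold cnt
    rw [Fintype.card_subtype]
  rw [hsub, hsub, hsub]
  let e : {r : List.Vector Bool (m + d) // r.toList ∈ {y : List Bool | y.take m ∈ E ∧ y.drop m ∈ F}} ≃
      {r : List.Vector Bool m // r.toList ∈ E} × {r : List.Vector Bool d // r.toList ∈ F} :=
    { toFun := fun r =>
        (⟨⟨r.1.toList.take m, by simp [r.1.toList_length]⟩, r.2.1⟩,
          ⟨⟨r.1.toList.drop m, by simp [r.1.toList_length]⟩, r.2.2⟩)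
      invFun := fun q =>
        ⟨⟨q.1.1.toList ++ q.2.1.toList, by simp [q.1.1.toList_length, q.2.1.toList_length]⟩, by
          constructor
          · change (q.1.1.toList ++ q.2.1.toList).take m ∈ E
            rw [List.take_left' q.1.1.toList_length]; exact q.1.2
          · change (q.1.1.toList ++ q.2.1.toList).drop m ∈ F
            rw [List.drop_left' q.1.1.toList_length]; exact q.2.2⟩
      left_inv := by
        rintro ⟨⟨r, hr⟩, h⟩
        apply Subtype.ext; apply Subtype.ext
        exact List.take_append_drop m r
      right_inv := by
        rintro ⟨⟨⟨a, ha⟩, h⟩, ⟨⟨b, hb⟩, h'⟩⟩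
        refine Prod.ext (Subtype.ext (Subtype.ext ?_)) (Subtype.ext (Subtype.ext ?_))
        · exact List.take_left' ha
        · exact List.drop_left' ha }
  have h := Fintype.card_congr e
  rw [Fintype.card_prod] at h
  convert h using 2

/-- **Discharge of `RP_subset_BPP`** (Arora–Barak 2009, §7.3; Gill 1977, Thm. 6.5): run the `RP`
machine twice on the two halves of `2p(n)` independent coins and accept if either run accepts —
witness language `(truncSndFn p)⁻¹(L') ⊔ (dropSndFn p)⁻¹(L') ∈ P` (`CoinTruncation.lean`,
`StringCopy.union_mem_P`). If `x ∈ L` the rejecting coin strings number `(2^m - a)^2 ≤ 4^m / 4`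
(`a ≥ 2^{m-1}` accepting strings of length `m`, `cnt_take_drop`), so the acceptance probability is
`≥ 3/4 ≥ 2/3`; if `x ∉ L` no coin string accepts, so every verdict is correct. [cite: AroraBarakCC2009, §7.3] -/
theorem RP_subset_BPP_holds : RP_subset_BPP := by
  rintro L ⟨L', hL', p, hp⟩
  set W : Language Bool := truncSndFn p ⁻¹' L' ⊔ dropSndFn p ⁻¹' L' with hW
  have hWP : W ∈ Classes.P :=
    union_mem_P (preimage_mem_P hL' (truncSndFn_mem_FP p)) (preimage_mem_P hL' (dropSndFn_mem_FP p))
  have hmemW : ∀ x y : List Bool, boolPair x y ∈ W ↔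
      boolPair x (y.take (p.eval x.length)) ∈ L' ∨ boolPair x (y.drop (p.eval x.length)) ∈ L' :=
    fun x y => by
      change truncSndFn p (boolPair x y) ∈ L' ∨ dropSndFn p (boolPair x y) ∈ L' ↔ _
      rw [truncSndFn_boolPair, dropSndFn_boolPair]
  refine ⟨W, hWP, 2 * p, fun x => ?_⟩
  have hmemx : ∀ y : List Bool, boolPair x y ∈ W ↔
      boolPair x (y.take (p.eval x.length)) ∈ L' ∨ boolPair x (y.drop (p.eval x.length)) ∈ L' :=
    hmemW x
  clear hmemW
  have hpx := hp x
  clear hp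
  have hm2 : (2 * p : ℕ[X]).eval x.length = p.eval x.length + p.eval x.length := by simp; ring
  rw [hm2, uniformProb_eq_cnt_div, le_div_iff₀ (by positivity)]
  generalize hm : p.eval x.length = m at *
  set E : Set (List Bool) := {c | boolPair x c ∈ L'} with hE
  by_cases hx : x ∈ L
  · -- accepting strings: prefix or suffix in `E`; complement counted by the product rule
    have ha : 2 ^ m ≤ 2 * cnt m E := by
      have h := hpx.1 hx
      rw [uniformProb_eq_cnt_div, le_div_iff₀ (by positivity)] at h
      have h' : ((2 ^ m : ℕ) : ℝ) ≤ ((2 * cnt m E : ℕ) : ℝ) := by push_cast; linarith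
      exact_mod_cast h'
    have hset : {y : List Bool | (boolPair x y ∈ W ↔ x ∈ L)} = {y | y.take m ∈ E ∨ y.drop m ∈ E} := by
      ext y; simp only [Set.mem_setOf_eq, hx, iff_true, hmemx, hE]
    have hcompl : cnt (m + m) {y : List Bool | y.take m ∈ E ∨ y.drop m ∈ E} +
        cnt (m + m) {y : List Bool | y.take m ∈ Eᶜ ∧ y.drop m ∈ Eᶜ} = 2 ^ (m + m) := by
      rw [← cnt_add_cnt_compl (m + m) {y : List Bool | y.take m ∈ E ∨ y.drop m ∈ E}]
      congr 1
      exact cnt_congr fun y _ => by simp [not_or]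
    have hprod := cnt_take_drop m m Eᶜ Eᶜ
    have hEc := cnt_add_cnt_compl m E
    rw [hset]
    -- integer arithmetic: t = 2^m, a = cnt m E, b = t - a with 2b ≤ t
    have key : 2 * 2 ^ (m + m) ≤ 3 * cnt (m + m) {y : List Bool | y.take m ∈ E ∨ y.drop m ∈ E} := by
      rw [hprod] at hcompl
      have hpow : (2 : ℕ) ^ (m + m) = 2 ^ m * 2 ^ m := pow_add 2 m m
      nlinarith [hcompl, hEc, ha, hpow, Nat.zero_le (cnt m Eᶜ), Nat.zero_le (cnt m E)]
    have key' : ((2 * 2 ^ (m + m) : ℕ) : ℝ) ≤ ((3 * cnt (m + m) {y : List Bool | y.take m ∈ E ∨ y.drop m ∈ E} : ℕ) : ℝ) := by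
      exact_mod_cast key
    push_cast at key'
    linarith
  · -- no accepting strings of length `m`: every coin string of length `2m` gives the verdict `x ∉ L`
    have hall : cnt (m + m) {y : List Bool | (boolPair x y ∈ W ↔ x ∈ L)} = 2 ^ (m + m) :=
      cnt_eq_two_pow_of_forall fun y hy => by
        simp only [Set.mem_setOf_eq, hx, iff_false, hmemx, not_or]
        have hneg := hpx.2 hx
        exact ⟨hneg _ (by rw [List.length_take]; omega), hneg _ (by rw [List.length_drop]; omega)⟩
    rw [hall]
    push_cast
    nlinarith [pow_pos (show (0 : ℝ) < 2 by norm_num) (m + m)]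

/-! ### Gill's machine form of `BPP` (`mem_BPP_iff_randAlg`) -/

/-- The verdict bit of `L'` at `z` equals the bit `[x ∈ L]` iff the verdict is correct,
`z ∈ L' ↔ x ∈ L` (the event of Arora–Barak's Def. 7.3, `M(x, r) = L(x)`). [folklore] -/
theorem boolIndicator_eq_boolIndicator_iff {L L' : Language Bool} (z x : List Bool) :
    L'.boolIndicator z = L.boolIndicator x ↔ (z ∈ L' ↔ x ∈ L) := by
  by_cases hz : z ∈ L' <;> by_cases hx : x ∈ L
  · rw [(Set.mem_iff_boolIndicator _ _).1 hz, (Set.mem_iff_boolIndicator _ _).1 hx]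
    simp [hz, hx]
  · rw [(Set.mem_iff_boolIndicator _ _).1 hz, (Set.notMem_iff_boolIndicator _ _).1 hx]
    simp [hz, hx]
  · rw [(Set.notMem_iff_boolIndicator _ _).1 hz, (Set.mem_iff_boolIndicator _ _).1 hx]
    simp [hz, hx]
  · rw [(Set.notMem_iff_boolIndicator _ _).1 hz, (Set.notMem_iff_boolIndicator _ _).1 hx]
    simp [hz, hx]

/-- **Discharge of `mem_BPP_iff_randAlg`**: Gill's machine definition of `BPP` (polynomial
bounded probabilistic machines with bounded error) coincides with the operator class `bp P`
(Arora–Barak's "alternative definition" by deterministic polynomial-time machines reading a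
random string `r ∈ {0,1}^{p(|x|)}`), in the vendored `RandAlg` form with an exactly polynomial
coin budget.
(→) For `L ∈ bp P` with witness `L' ∈ P` and coin polynomial `p`, the algorithm
`A = ⟨(x, r) ↦ [⟨x, r⟩ ∈ L'], p⟩` is probabilistic polynomial time — its run map, read through
the pairing `boolPair`, *is* the decider of `L'` (same machine, same polynomial;
`mem_P_iff_holds`) — uses exactly `p(n)` coins, and `Pr_r[A(x, r) = [x ∈ L]]` is the counting
probability of the correct-verdict event `{y | ⟨x, y⟩ ∈ L' ↔ x ∈ L}`
(`PMF.toOuterMeasure_map_apply`, `uniformProb_eq_toOuterMeasure`).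
(←) Given `A`, polynomial time on the machine inputs `⟨x, r⟩` and with `coinLen = q`, take the
witness `L' = {w | A.run (boolUnpair w).1 (boolUnpair w).2 = true}`. Its indicator is
`uncurry A.run ∘ boolUnpair`, polynomial time on **all** strings as the composite
(`PolyTimeComputable.comp_holds`, `TimeBoundsProofs.lean`) of the given machine with the
re-pairing normaliser `z ↦ ⟨(boolUnpair z).1, (boolUnpair z).2⟩`
(`polyTimeComputable_boolUnpair`, `PairingMachines.lean`), which handles the malformed strings
outside the image of `boolPair`; hence `L' ∈ P` (`mem_P_iff_holds`). Since
`⟨x, y⟩ ∈ L' ↔ A.run x y = true` (`boolUnpair_boolPair`), the `bp` event at `x` for the coin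
polynomial `q` is `{y | A.run x y = [x ∈ L]}`, of probability `A.pr id x {[x ∈ L]} ≥ 2/3`.
[Gill 1977, Def. 5.1(ii) (p. 685: "BPP is the class of languages recognized by polynomial
bounded PTMs with bounded error probability") with Def. 2.8; Arora–Barak 2009, Def. 7.2
(p. 125) and Def. 7.3 (BPP, alternative definition, p. 126)]
[cite: Gill1977, Def. 5.1(ii)] [cite: AroraBarakCC2009, Def. 7.3] -/
theorem mem_BPP_iff_randAlg_holds : mem_BPP_iff_randAlg := by
  intro L
  constructor
  · rintro ⟨L', hL', p, hp⟩
    refine ⟨⟨fun x r => L'.boolIndicator (boolPair x r), fun n => p.eval n⟩, ?_,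
      ⟨p, fun n => rfl⟩, fun x => ?_⟩
    · -- polynomial time: the decider of `L'`, read through the pairing
      refine ⟨?_, p, fun n => le_rfl⟩
      obtain ⟨P₀, M, hM⟩ := polyTimeDecidable_iff.1 (mem_P_iff_holds.1 hL')
      exact ⟨P₀, M, fun q => hM (boolPair q.1 q.2)⟩
    · -- success probability = counting probability of the correct-verdict event
      have hset :
          {y : List Bool | L'.boolIndicator (boolPair x y) ∈ ({L.boolIndicator x} : Set Bool)} =
            {y : List Bool | boolPair x y ∈ L' ↔ x ∈ L} :=
        Set.ext fun y => boolIndicator_eq_boolIndicator_iff (boolPair x y) x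
      have key : RandAlg.pr ⟨fun x r => L'.boolIndicator (boolPair x r), fun n => p.eval n⟩ id x
            {L.boolIndicator x} =
          uniformProb (p.eval x.length) {y : List Bool | boolPair x y ∈ L' ↔ x ∈ L} := by
        rw [uniformProb_eq_toOuterMeasure, RandAlg.pr, RandAlg.outputPMF,
          PMF.toOuterMeasure_map_apply, ← hset]
        rfl
      rw [key]
      exact hp x
  · rintro ⟨A, ⟨hrun, -⟩, ⟨q, hq⟩, hpr⟩
    set L' : Language Bool := {w | A.run (boolUnpair w).1 (boolUnpair w).2 = true}
    -- the indicator of `L'` is the run map behind the unpairing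
    have hind : L'.boolIndicator = Function.uncurry A.run ∘ boolUnpair := by
      funext w
      change L'.boolIndicator w = A.run (boolUnpair w).1 (boolUnpair w).2
      unfold Set.boolIndicator
      split_ifs with h
      · exact (h : A.run (boolUnpair w).1 (boolUnpair w).2 = true).symm
      · have h' : ¬ A.run (boolUnpair w).1 (boolUnpair w).2 = true := h
        rw [Bool.not_eq_true] at h'
        exact h'.symm
    -- `L' ∈ P`: compose the given machine with the re-pairing normaliser
    have hP : L' ∈ Classes.P := by
      refine mem_P_iff_holds.2 (polyTimeDecidable_iff.2 ?_)
      rw [hind]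
      exact PolyTimeComputable.comp_holds hrun polyTimeComputable_boolUnpair
    refine ⟨L', hP, q, fun x => ?_⟩
    -- the `bp` event at `x` is `{y | A.run x y = [x ∈ L]}`
    have hset : {y : List Bool | boolPair x y ∈ L' ↔ x ∈ L} =
        {y : List Bool | A.run x y ∈ ({L.boolIndicator x} : Set Bool)} := by
      ext y
      change (A.run (boolUnpair (boolPair x y)).1 (boolUnpair (boolPair x y)).2 = true ↔ x ∈ L) ↔
        A.run x y ∈ ({L.boolIndicator x} : Set Bool)
      rw [boolUnpair_boolPair, Set.mem_singleton_iff]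
      by_cases hx : x ∈ L
      · rw [(Set.mem_iff_boolIndicator _ _).1 hx]
        simp [hx]
      · rw [(Set.notMem_iff_boolIndicator _ _).1 hx]
        simp [hx]
    have key : uniformProb (q.eval x.length) {y : List Bool | boolPair x y ∈ L' ↔ x ∈ L} =
        A.pr id x {L.boolIndicator x} := by
      rw [hset, uniformProb_eq_toOuterMeasure, RandAlg.pr, RandAlg.outputPMF,
        PMF.toOuterMeasure_map_apply, ← hq]
      rfl
    rw [key]
    exact hpr x

end Literature.Computability.Complexity
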